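import Mathlib.CategoryTheory.Comma.Over.Pullback
import Literature.AnabelianGeometry.SemiGraphs.Coverticial
import Literature.AnabelianGeometry.SemiGraphs.BaseChange
import Literature.AnabelianGeometry.SemiGraphs.GraphCoveringObject
import Literature.AnabelianGeometry.Anabelioids.TerminalCoproductComponents

/-!
# A graph-covering of the underlying semi-graph is a finite étale covering ([SemiAnbd] §2 p. 23)

Mochizuki, *Semi-graphs of anabelioids*, Publ. RIMS **42** (2006) 221–322, §2 p. 23
[cite: MochizukiSemiAnbd2006, Def. 2.2(i) p.23]: a finite étale covering `𝒢' → 𝒢` "arises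
naturally as the `B(−)` of some semi-graph of anabelioids `𝒢'` … which lies over some proper
morphism of semi-graphs", the vertices of `𝔾'` over `v` being "the connected components of
`B' ×_B 𝒢_v`".  This file proves the basic instance of that dictionary, the one used in the proof of
Proposition 2.6 (p. 29: "we may construct a finite graph-covering … which is trivial over `𝕂`"):
for a finite graph-covering `ψ : 𝔾' → 𝔾` of the underlying semi-graph (`𝔾'` a graph), the base
change `𝒢 ×_𝔾 𝔾' → 𝒢` (`BaseChange.lean`) IS the finite étale covering attached to the object
`coveringObj ψ = (∐_{ψ⁻¹ v} 1, ∐_{ψ⁻¹ e} 1, branch-bijection gluings)` of `B(𝒢)`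
(`GraphCoveringObject.lean`), in the precise sense of `Hom.IsFiniteEtaleCoveringOf`
(`Coverticial.lean`, Definition 2.2 (i) as typed by the cell): `comapHom_isFiniteEtaleCoveringOf`,
`comapHom_isFiniteEtaleCovering`.

Ingredients: the connected components of `∐_J 1` are the `J` summands
(`TerminalCoproductComponents.lean`); the slice of a Galois category over (a copy of) `1` is the
category itself (`Over.equivalenceOfIsTerminal`, `1 × Y ≅ Y`); the sheet compatibility of the gluings
(`map_ι_comp_coveringGluing_hom`).  No new definitions.
-/

namespace Literature.AnabelianGeometry.SemiGraphs

namespace SemiGraphOfAnabelioids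

open CategoryTheory CategoryTheory.Limits CategoryTheory.PreGaloisCategory
open Literature.AnabelianGeometry.Anabelioids

universe v₁ u₁ u

variable (𝒢 : SemiGraphOfAnabelioids.{v₁, u₁, u}) {G' : SemiGraph.{u}} (ψ : G' ⟶ 𝒢.graph)

/-! ### The slice over a terminal object -/

/-- For a terminal object `P` of a category with binary products, `P × (−) ≅ 𝟭`: the composite
`Over.star P ⋙ Over.forget P` is isomorphic to the identity. [cite: SGA1, Exp. V §5] -/
private theorem nonempty_id_iso_star_comp_forget {C : Type*} [Category C] [HasBinaryProducts C]
    {P : C} (hP : IsTerminal P) : Nonempty (𝟭 C ≅ Over.star P ⋙ Over.forget P) := by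
  refine ⟨(NatIso.ofComponents (fun Y => ?_) ?_).symm⟩
  · exact { hom := (prod.snd : P ⨯ Y ⟶ Y)
            inv := prod.lift (hP.from Y) (𝟙 Y)
            hom_inv_id := by
              apply Limits.prod.hom_ext
              · exact hP.hom_ext _ _
              · show (prod.snd ≫ prod.lift (hP.from Y) (𝟙 Y)) ≫ (prod.snd : P ⨯ Y ⟶ Y) =
                  𝟙 (P ⨯ Y) ≫ prod.snd
                rw [Category.assoc, prod.lift_snd, Category.comp_id, Category.id_comp]
            inv_hom_id := prod.lift_snd _ _ }
  · intro X Y f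
    exact prod.map_snd (𝟙 P) f

/-! ### The main theorem -/

variable {ψ}

/-- The branch clause of `IsFiniteEtaleCoveringOf` for the base change along a graph-covering, with
the edge equation `edgeOf (ψ b') = e₂` generalised so that the transports reduce to identities.
[cite: MochizukiSemiAnbd2006, Def. 2.2(i) p.23] -/
private theorem branch_clause_aux [∀ v, Finite (ψ.VertexFiber v)] [∀ e, Finite (ψ.EdgeFiber e)]
    (hψ : SemiGraph.IsExcision ψ) (hG' : G'.IsGraph)
    (b' : G'.Branch) (v' : G'.Vertex) (h' : G'.abuts b' = some v')
    (e₂ : 𝒢.graph.Edge) (he : 𝒢.graph.edgeOf (ψ.branchMap b') = e₂)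
    (p₂ : ψ.edgeMap (G'.edgeOf b') = e₂) :
    ∃ f : ((Subobject.mk (Sigma.ι (fun _ : ψ.EdgeFiber e₂ => ⊤_ (𝒢.E e₂)) ⟨G'.edgeOf b', p₂⟩)) :
          𝒢.E e₂) ⟶
        (𝒢.transportE he).obj ((𝒢.pull (ψ.branchMap b') (ψ.vertexMap v')
          (ψ.abuts_branchMap b' v' h')).pullback.obj
            ((Subobject.mk (Sigma.ι (fun _ : ψ.VertexFiber (ψ.vertexMap v') =>
              ⊤_ (𝒢.V (ψ.vertexMap v'))) ⟨v', rfl⟩)) : 𝒢.V (ψ.vertexMap v'))),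
      f ≫ (𝒢.transportE he).map
          ((𝒢.pull (ψ.branchMap b') (ψ.vertexMap v') (ψ.abuts_branchMap b' v' h')).pullback.map
              (Subobject.mk (Sigma.ι (fun _ : ψ.VertexFiber (ψ.vertexMap v') =>
                ⊤_ (𝒢.V (ψ.vertexMap v'))) ⟨v', rfl⟩)).arrow ≫
            (𝒢.coveringGluing hψ hG' (ψ.branchMap b') (ψ.vertexMap v')
              (ψ.abuts_branchMap b' v' h')).hom) ≫
        eqToHom (𝒢.transportE_obj_T (𝒢.coveringObj hψ hG') he) =
      (Subobject.mk (Sigma.ι (fun _ : ψ.EdgeFiber e₂ => ⊤_ (𝒢.E e₂)) ⟨G'.edgeOf b', p₂⟩)).arrow := by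
  subst he
  -- the branch over `ψ b'` at `v'` is `b'`, so the sheet of `T_e` hit from the sheet `v'` is `edgeOf b'`
  have hlift : (SemiGraph.Hom.branchLift hψ (ψ.branchMap b') (ψ.vertexMap v')
      (ψ.abuts_branchMap b' v' h') ⟨v', rfl⟩).1 = b' :=
    (SemiGraph.Hom.eq_branchLift hψ _ _ _ ⟨v', rfl⟩ b' h' rfl).symm
  have hε : SemiGraph.Hom.fiberEquivOfBranch hψ hG' (ψ.branchMap b') (ψ.vertexMap v')
      (ψ.abuts_branchMap b' v' h') ⟨v', rfl⟩ = ⟨G'.edgeOf b', p₂⟩ := by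
    apply Subtype.ext
    rw [SemiGraph.Hom.fiberEquivOfBranch_apply_val, hlift]
  have hι : (Sigma.ι (fun _ : ψ.EdgeFiber (𝒢.graph.edgeOf (ψ.branchMap b')) =>
        ⊤_ (𝒢.E (𝒢.graph.edgeOf (ψ.branchMap b'))))
        (SemiGraph.Hom.fiberEquivOfBranch hψ hG' (ψ.branchMap b') (ψ.vertexMap v')
          (ψ.abuts_branchMap b' v' h') ⟨v', rfl⟩) :
        ⊤_ (𝒢.E (𝒢.graph.edgeOf (ψ.branchMap b'))) ⟶ _) =
      Sigma.ι (fun _ : ψ.EdgeFiber (𝒢.graph.edgeOf (ψ.branchMap b')) =>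
        ⊤_ (𝒢.E (𝒢.graph.edgeOf (ψ.branchMap b')))) ⟨G'.edgeOf b', p₂⟩ :=
    congrArg (fun j : ψ.EdgeFiber (𝒢.graph.edgeOf (ψ.branchMap b')) =>
      (Sigma.ι (fun _ : ψ.EdgeFiber (𝒢.graph.edgeOf (ψ.branchMap b')) =>
        ⊤_ (𝒢.E (𝒢.graph.edgeOf (ψ.branchMap b')))) j :
          ⊤_ (𝒢.E (𝒢.graph.edgeOf (ψ.branchMap b'))) ⟶ _)) hε
  refine ⟨(Subobject.underlyingIso _).hom ≫
    (PreservesTerminal.iso (𝒢.pull (ψ.branchMap b') (ψ.vertexMap v')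
      (ψ.abuts_branchMap b' v' h')).pullback).inv ≫
    (𝒢.pull (ψ.branchMap b') (ψ.vertexMap v') (ψ.abuts_branchMap b' v' h')).pullback.map
      (Subobject.underlyingIso _).inv, ?_⟩
  change ((Subobject.underlyingIso _).hom ≫ (PreservesTerminal.iso _).inv ≫
      (𝒢.pull (ψ.branchMap b') (ψ.vertexMap v') (ψ.abuts_branchMap b' v' h')).pullback.map
        (Subobject.underlyingIso _).inv) ≫
    ((𝒢.pull (ψ.branchMap b') (ψ.vertexMap v') (ψ.abuts_branchMap b' v' h')).pullback.map
        (Subobject.mk (Sigma.ι (fun _ : ψ.VertexFiber (ψ.vertexMap v') =>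
          ⊤_ (𝒢.V (ψ.vertexMap v'))) ⟨v', rfl⟩)).arrow ≫
      (𝒢.coveringGluing hψ hG' (ψ.branchMap b') (ψ.vertexMap v')
        (ψ.abuts_branchMap b' v' h')).hom) ≫ 𝟙 _ = _
  rw [Category.comp_id, ← Subobject.underlyingIso_hom_comp_eq_mk
    (Sigma.ι (fun _ : ψ.VertexFiber (ψ.vertexMap v') => ⊤_ (𝒢.V (ψ.vertexMap v'))) ⟨v', rfl⟩),
    CategoryTheory.Functor.map_comp]
  simp only [Category.assoc]
  rw [𝒢.map_ι_comp_coveringGluing_hom hψ hG' (ψ.branchMap b') (ψ.vertexMap v')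
    (ψ.abuts_branchMap b' v' h') ⟨v', rfl⟩, ← CategoryTheory.Functor.map_comp_assoc, Iso.inv_hom_id,
    CategoryTheory.Functor.map_id, Category.id_comp, Iso.inv_hom_id_assoc, hι,
    Subobject.underlyingIso_hom_comp_eq_mk]

/-- **[SemiAnbd] p. 23 for graph-coverings: `𝒢 ×_𝔾 𝔾' → 𝒢` is the finite étale covering attached to
`coveringObj ψ`** — for a proper excision (graph-covering) `ψ : 𝔾' → 𝔾` with finite fibres and
`𝔾'` a graph, the tautological morphism `comapHom ψ` satisfies Definition 2.2 (i) as typed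
(`Hom.IsFiniteEtaleCoveringOf`): it is proper; the vertices (edges) of `𝔾'` over `v` (`e`) are in
bijection with the connected components of `∐_{ψ⁻¹ v} 1` (`∐_{ψ⁻¹ e} 1`) — the summands; the
constituent `(𝒢 ×_𝔾 𝔾')_{v'} = 𝒢_v` is the slice of `𝒢_v` over the sheet `1`; and the branches
match the sheets through the gluings. [cite: MochizukiSemiAnbd2006, Def. 2.2(i) p.23] -/
theorem comapHom_isFiniteEtaleCoveringOf [∀ v, Finite (ψ.VertexFiber v)]
    [∀ e, Finite (ψ.EdgeFiber e)] (hprop : SemiGraph.IsProper ψ) (hψ : SemiGraph.IsExcision ψ)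
    (hG' : G'.IsGraph) :
    (𝒢.comapHom ψ).IsFiniteEtaleCoveringOf (𝒢.coveringObj hψ hG') := by
  classical
  refine ⟨hprop, ?_⟩
  -- the components: the summand indexed by the vertex / edge itself
  let cV : ∀ v' : G'.Vertex, π₀Obj ((𝒢.coveringObj hψ hG').S (ψ.vertexMap v')) := fun v' =>
    ⟨Subobject.mk (Sigma.ι (fun _ : ψ.VertexFiber (ψ.vertexMap v') =>
        ⊤_ (𝒢.V (ψ.vertexMap v'))) ⟨v', rfl⟩),
      isConnected_subobjectMk_sigma_ι (C := 𝒢.V (ψ.vertexMap v')) _ _⟩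
  let cE : ∀ e' : G'.Edge, π₀Obj ((𝒢.coveringObj hψ hG').T (ψ.edgeMap e')) := fun e' =>
    ⟨Subobject.mk (Sigma.ι (fun _ : ψ.EdgeFiber (ψ.edgeMap e') =>
        ⊤_ (𝒢.E (ψ.edgeMap e'))) ⟨e', rfl⟩),
      isConnected_subobjectMk_sigma_ι (C := 𝒢.E (ψ.edgeMap e')) _ _⟩
  refine ⟨cV, cE, ?_, ?_, ?_, ?_, ?_⟩
  · -- bijectivity on vertices: the inverse picks the sheet of a connected component
    have key : ∀ v' : G'.Vertex, (Classical.choose (exists_eq_subobjectMk_sigma_ι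
        (C := 𝒢.V (ψ.vertexMap v')) (ψ.VertexFiber (ψ.vertexMap v')) (cV v').1 (cV v').2)).1 = v' := by
      intro v'
      have hspec := Classical.choose_spec (exists_eq_subobjectMk_sigma_ι
        (C := 𝒢.V (ψ.vertexMap v')) (ψ.VertexFiber (ψ.vertexMap v')) (cV v').1 (cV v').2)
      exact (congrArg Subtype.val (subobjectMk_sigma_ι_injective (C := 𝒢.V (ψ.vertexMap v'))
        (ψ.VertexFiber (ψ.vertexMap v')) hspec)).symm
    have hli : Function.LeftInverse (fun q : Σ v, π₀Obj ((𝒢.coveringObj hψ hG').S v) =>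
        (Classical.choose (exists_eq_subobjectMk_sigma_ι (C := 𝒢.V q.1) (ψ.VertexFiber q.1)
          q.2.1 q.2.2)).1)
        (fun v' : (𝒢.comap ψ).graph.Vertex =>
          (⟨(𝒢.comapHom ψ).base.vertexMap v', cV v'⟩ : Σ v, π₀Obj ((𝒢.coveringObj hψ hG').S v))) :=
      key
    refine ⟨hli.injective, ?_⟩
    · rintro ⟨v, P, hP⟩
      obtain ⟨⟨w, hw⟩, hj⟩ := exists_eq_subobjectMk_sigma_ι (C := 𝒢.V v) (ψ.VertexFiber v) P hP
      subst hw
      exact ⟨w, Sigma.ext rfl (heq_of_eq (Subtype.ext hj.symm))⟩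
  · -- bijectivity on edges
    have key : ∀ e' : G'.Edge, (Classical.choose (exists_eq_subobjectMk_sigma_ι
        (C := 𝒢.E (ψ.edgeMap e')) (ψ.EdgeFiber (ψ.edgeMap e')) (cE e').1 (cE e').2)).1 = e' := by
      intro e'
      have hspec := Classical.choose_spec (exists_eq_subobjectMk_sigma_ι
        (C := 𝒢.E (ψ.edgeMap e')) (ψ.EdgeFiber (ψ.edgeMap e')) (cE e').1 (cE e').2)
      exact (congrArg Subtype.val (subobjectMk_sigma_ι_injective (C := 𝒢.E (ψ.edgeMap e'))
        (ψ.EdgeFiber (ψ.edgeMap e')) hspec)).symm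
    have hli : Function.LeftInverse (fun q : Σ e, π₀Obj ((𝒢.coveringObj hψ hG').T e) =>
        (Classical.choose (exists_eq_subobjectMk_sigma_ι (C := 𝒢.E q.1) (ψ.EdgeFiber q.1)
          q.2.1 q.2.2)).1)
        (fun e' : (𝒢.comap ψ).graph.Edge =>
          (⟨(𝒢.comapHom ψ).base.edgeMap e', cE e'⟩ : Σ e, π₀Obj ((𝒢.coveringObj hψ hG').T e))) :=
      key
    refine ⟨hli.injective, ?_⟩
    · rintro ⟨e, P, hP⟩
      obtain ⟨⟨e', he'⟩, hj⟩ := exists_eq_subobjectMk_sigma_ι (C := 𝒢.E e) (ψ.EdgeFiber e) P hP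
      subst he'
      exact ⟨e', Sigma.ext rfl (heq_of_eq (Subtype.ext hj.symm))⟩
  · -- the vertex constituents: `𝒢_v` is the slice of `𝒢_v` over the sheet `1`
    intro v'
    have hP : IsTerminal ((cV v').1 : 𝒢.V (ψ.vertexMap v')) :=
      terminalIsTerminal.ofIso (Subobject.underlyingIso (Sigma.ι
        (fun _ : ψ.VertexFiber (ψ.vertexMap v') => ⊤_ (𝒢.V (ψ.vertexMap v'))) ⟨v', rfl⟩)).symm
    exact ⟨(Over.equivalenceOfIsTerminal hP).functor, inferInstance,
      nonempty_id_iso_star_comp_forget hP⟩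
  · -- the edge constituents
    intro e'
    have hP : IsTerminal ((cE e').1 : 𝒢.E (ψ.edgeMap e')) :=
      terminalIsTerminal.ofIso (Subobject.underlyingIso (Sigma.ι
        (fun _ : ψ.EdgeFiber (ψ.edgeMap e') => ⊤_ (𝒢.E (ψ.edgeMap e'))) ⟨e', rfl⟩)).symm
    exact ⟨(Over.equivalenceOfIsTerminal hP).functor, inferInstance,
      nonempty_id_iso_star_comp_forget hP⟩
  · -- branches match sheets through the gluings
    intro b' v' h'
    exact 𝒢.branch_clause_aux hψ hG' b' v' h' (ψ.edgeMap (G'.edgeOf b'))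
      (ψ.edgeOf_branchMap b') rfl

/-- **A finite graph-covering of the underlying semi-graph is a finite étale covering of `𝒢`**
([SemiAnbd] p. 23; Definition 2.2 (i)): for `ψ : 𝔾' → 𝔾` a finite graph-covering with `𝔾'` a
graph, `𝒢 ×_𝔾 𝔾' → 𝒢` is a finite étale covering. [cite: MochizukiSemiAnbd2006, Def. 2.2(i) p.23] -/
theorem comapHom_isFiniteEtaleCovering (hψ : SemiGraph.IsFiniteGraphCovering ψ)
    (hG' : G'.IsGraph) : (𝒢.comapHom ψ).IsFiniteEtaleCovering := by
  haveI : ∀ v, Finite (ψ.VertexFiber v) := hψ.2.1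
  haveI : ∀ e, Finite (ψ.EdgeFiber e) := hψ.2.2
  exact ⟨_, 𝒢.comapHom_isFiniteEtaleCoveringOf hψ.1.1 hψ.1.2 hG'⟩

end SemiGraphOfAnabelioids

end Literature.AnabelianGeometry.SemiGraphs
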